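import Literature.NumberTheory.Transcendental.KZSemialgebraicComplex
import Summits.KontsevichZagierPeriods.KontsevichZagierPeriods.Theses.DefinableMoves

/-!
# Route DefinableMoves — `AlgebraicCoefficients`

Item `stmt-KontsevichZagierPeriods-4091` of route `route-KontsevichZagierPeriods-DefinableMoves`:
a subset of `ℝⁿ` which is semialgebraic over the ring of real algebraic numbers
`integralClosure ℚ ℝ` is already semialgebraic over `ℚ` [Kontsevich–Zagier 2001, §1.1: "rational"
may be replaced by "algebraic"; Bochnak–Coste–Roy 1998, §2.1–2.2].

Proof. By induction over the generating Boolean combinations it suffices to treat the generators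
`{x | p x = 0}` and `{x | 0 < p x}` for `p ∈ ℝ_alg[X₁, …, Xₙ]`. By induction on `p`
(constants / sums / multiplication by a variable) the polynomial function `x ↦ p x` is a
`ℚ`-semialgebraic FUNCTION on `ℝⁿ`: a real algebraic constant `c` is `ℚ`-definable
(`{t = c} = {f t = 0, a < t < b}` for `f ∈ ℚ[X]`, `f c = 0`, and an isolating rational interval —
tree `isSemialgebraicFunOn_const_of_isAlgebraic`), and sums and products of `ℚ`-semialgebraic
functions are `ℚ`-semialgebraic by the Tarski–Seidenberg theorem (tree `IsSemialgebraicFunOn.add_holds`,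
`mul_holds`, resting on `tarski_seidenberg_real_holds`). Finally `{p = 0}` and `{0 < p}` are
obtained from the graph of `p` by graph elimination (`isSemialgebraic_sep_snoc_mem`) against the
`ℚ`-semialgebraic sets `{z | z_last = 0}`, `{z | 0 < z_last}`.
-/

noncomputable section

open Set MvPolynomial
open Literature.ModelTheory.ExponentialFields Literature.NumberTheory.Transcendental

namespace Summit.KontsevichZagierPeriods.DefinableMoves

/-- A polynomial in `n` variables with real algebraic coefficients defines a `ℚ`-semialgebraic
function on `ℝⁿ` (its graph is `ℚ`-semialgebraic): induction on the polynomial, using that real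
algebraic constants are `ℚ`-definable and that sums and products of real semialgebraic functions
are semialgebraic (Tarski–Seidenberg). [Kontsevich–Zagier 2001, §1.1; Bochnak–Coste–Roy 1998,
Prop. 2.2.6] -/
theorem isSemialgebraicFunOn_aeval_integralClosure {n : ℕ}
    (p : MvPolynomial (Fin n) (integralClosure ℚ ℝ)) :
    IsSemialgebraicFunOn ℚ (univ : Set (Fin n → ℝ)) (fun x => aeval x p) := by
  induction p using MvPolynomial.induction_on with
  | C a =>
    have ha : IsAlgebraic ℚ (a : ℝ) := (show IsIntegral ℚ (a : ℝ) from a.2).isAlgebraic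
    have h := isSemialgebraicFunOn_const_of_isAlgebraic (m := n) isSemialgebraic_univ ha
    refine h.congr fun x _ => ?_
    simp only [aeval_C]
    rfl
  | add p q hp hq =>
    have h := IsSemialgebraicFunOn.add_holds hp hq
    refine h.congr fun x _ => ?_
    simp only [Pi.add_apply, map_add]
  | mul_X p i hp =>
    have hX : IsSemialgebraicFunOn ℚ (univ : Set (Fin n → ℝ)) (fun x => x i) := by
      simpa using isSemialgebraicFunOn_aeval (R := ℝ) isSemialgebraic_univ
        (X i : MvPolynomial (Fin n) ℚ)
    have h := IsSemialgebraicFunOn.mul_holds hp hX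
    refine h.congr fun x _ => ?_
    simp only [Pi.mul_apply, map_mul, aeval_X]

/-- The zero set `{x | p x = 0}` of a polynomial with real algebraic coefficients is
`ℚ`-semialgebraic (graph elimination against `{z | z_last = 0}`).
[Kontsevich–Zagier 2001, §1.1; Bochnak–Coste–Roy 1998, §2.2] -/
theorem isSemialgebraic_rat_setOf_aeval_integralClosure_eq_zero {n : ℕ}
    (p : MvPolynomial (Fin n) (integralClosure ℚ ℝ)) :
    IsSemialgebraic ℚ {x : Fin n → ℝ | aeval x p = 0} := by
  have hT : IsSemialgebraic ℚ {z : Fin (n + 1) → ℝ | z (Fin.last n) = 0} := by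
    simpa using isSemialgebraic_setOf_eval_eq_zero (k := ℚ) (R := ℝ)
      (X (Fin.last n) : MvPolynomial (Fin (n + 1)) ℚ)
  convert (isSemialgebraicFunOn_aeval_integralClosure p).isSemialgebraic_sep_snoc_mem
    tarski_seidenberg_real_holds hT using 1
  ext x
  simp

/-- The positivity set `{x | 0 < p x}` of a polynomial with real algebraic coefficients is
`ℚ`-semialgebraic (graph elimination against `{z | 0 < z_last}`).
[Kontsevich–Zagier 2001, §1.1; Bochnak–Coste–Roy 1998, §2.2] -/
theorem isSemialgebraic_rat_setOf_aeval_integralClosure_pos {n : ℕ}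
    (p : MvPolynomial (Fin n) (integralClosure ℚ ℝ)) :
    IsSemialgebraic ℚ {x : Fin n → ℝ | 0 < aeval x p} := by
  have hT : IsSemialgebraic ℚ {z : Fin (n + 1) → ℝ | 0 < z (Fin.last n)} := by
    simpa using isSemialgebraic_setOf_eval_pos (k := ℚ) (R := ℝ)
      (X (Fin.last n) : MvPolynomial (Fin (n + 1)) ℚ)
  convert (isSemialgebraicFunOn_aeval_integralClosure p).isSemialgebraic_sep_snoc_mem
    tarski_seidenberg_real_holds hT using 1
  ext x
  simp

/-- **Route item `AlgebraicCoefficients`** (stmt-KontsevichZagierPeriods-4091): a subset of `ℝⁿ`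
semialgebraic over the real algebraic numbers `integralClosure ℚ ℝ` is semialgebraic over `ℚ`
[Kontsevich–Zagier 2001, §1.1 ("rational" may be replaced by "algebraic"); Bochnak–Coste–Roy 1998,
§2.1–2.2]. Induction over the generating Boolean combinations; the generators are handled by
`isSemialgebraic_rat_setOf_aeval_integralClosure_eq_zero` / `_pos`. -/
theorem algebraicCoefficients_proof :
    Summit.KontsevichZagierPeriods.KontsevichZagierPeriods.Theses.DefinableMoves.AlgebraicCoefficients := by
  unfold Summit.KontsevichZagierPeriods.KontsevichZagierPeriods.Theses.DefinableMoves.AlgebraicCoefficients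
  intro n S hS
  induction hS using BooleanSubalgebra.closure_bot_sup_induction with
  | mem t ht =>
    rcases ht with ⟨p, rfl⟩ | ⟨p, rfl⟩
    · exact isSemialgebraic_rat_setOf_aeval_integralClosure_eq_zero p
    · exact isSemialgebraic_rat_setOf_aeval_integralClosure_pos p
  | bot => exact isSemialgebraic_empty
  | sup s _ t _ hs ht => exact hs.union ht
  | compl s _ hs => exact hs.compl

end Summit.KontsevichZagierPeriods.DefinableMoves
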